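import Mathlib
import HarnessLib
import Summits.HubbardSuperconductivity.HubbardSuperconductivity.Theorems.KLProgrammeKLRegimeEnginePairTransferRelResIdx
import Summits.HubbardSuperconductivity.HubbardSuperconductivity.Theorems.KLProgrammeKLRegimeEngineRelGainWindowed

/-!
# Route `KLProgramme` — ENGINE child gen 8 (stmt-HubbardSuperconductivity-20437 `KLRegimeEngineV17F2`), skeleton v2 class #5 (Export5/6/7), Ẽ-organisation (KLTC-INDEX §B′):
# the EXPORT CONVERSION CLOSED — a private relative-residue family at ONE FIFTH of the public bar exports to `PairTransferRelFamilyK5`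
# (cell gate-hubbard-kl, seat hubbard-kl-k3c1-p1 g11, technique «composed-map remainder propagation»; located item #19 «(c)-DRESSING-AVG», (W2-a) rows of p1)

WHY.  `pairTransferRelFamilyK5_of_relResIdx` (p594718) exports the producer's private family «`‖Ẽ_n(s_{n,j} | s_{n,j′})(k,k′)‖ ≤ RB n j j′ Qm k k′` on the bare ball» to the
frozen K5 family once per scale, at the price of ONE conversion row per pair class: `RB(k,k′) + Σ_c RB(k,c)·|tₙ[s_j](c) − tₙ[s_j′](c)|·(3mA/2) ≤ transferBarRelIdx … n j′ Qm k k′`.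
With the windowed mass of the relative pinned weight ((W2-a), `klam_transferBarRelIdx_conv_transferWeight_le`, p597413) that row CLOSES for the natural choice
`RB := θ·transferBarRelIdx … n j′` with any `0 ≤ θ ≤ 1/5`, under the U-door row `mA·(4·15367) ≤ 1/3` and the frame binders (`FrameOK` of `Kₙ`, `klBetaMin ≤ β ≤ L`, `π/L ≤ Λₙ`):
the convolution of the bar's row with the weight is at most `3.1 ×` the bar's `k′`-free FLOOR (`(KlamU)²(2⁻ⁿ + 1/L)·ms + [(Klam|U|)³2⁻ⁿ + thermalBar]·ms`) per unit `(3mA/2)`,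
the gain profile's layer cake costing `(n+2)(4n+51)/50 ≤ 2.1·2ⁿ` at `I = 2n` (`klam_poly_le_pow`).
* `klIdxOverlap_le_klIdxMass`, `klam_poly_le_pow` (`(n+2)(4n+51) ≤ 105·2ⁿ`), **`klam_gain_numeric_le`** (`3mA·Gainₙ ≤ (21/10)·2⁻ⁿ` at `I = 2n` under the U-door row);
* **`klam_exportRow_le`** — for `0 ≤ θ ≤ 1/5`: `θ·Tb(k,k′) + Σ_c 𝟙[k,c ∈ B]·θ·Tb(k,c)·‖−(tₙ[s_j](c) − tₙ[s_j′](c))‖·(3mA/2) ≤ Tb(k,k′)`, `Tb = transferBarRelIdx L G P r β U n j′ Qm`;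
* **`pairTransferRelFamilyK5_of_relResIdx_fifth`** — the private family at `RB := θ·transferBarRelIdx` (`θ ≤ 1/5`) + the a priori size `|A°ₙ[s_{n,j′}]| ≤ mA` on the ball
  + the U-door row ⟹ `PairTransferRelFamilyK5 L M G P r β U μ n` (any `G` with `0 ≤ G.CF` — in rev 13 the thermal package `Gth`).
Arithmetic on landed bars and rows; nothing about the model beyond p1's (W2-a) rows is used; nothing asserts any stub, K3 or superconductivity.  0 kit · 0 lit.
-/

noncomputable section

namespace Summit.HubbardSuperconductivity.HubbardSuperconductivity.Theorems.KLRegimeSplit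

set_option linter.dupNamespace false -- summit = problem name (single-conjunct summit), D-0017

open Finset Matrix Literature.MathematicalPhysics.QuantumLattice Literature.Probability.LatticeModels
open Summit.HubbardSuperconductivity.HubbardSuperconductivity.Theorems.KLProgrammeLegKernels
open Summit.HubbardSuperconductivity.HubbardSuperconductivity.Theorems.DispersionFlow
open Summit.HubbardSuperconductivity.HubbardSuperconductivity.Theorems.EngineV8

/-! ## §1 Numerics -/

section Numerics

/-- The index overlap is below the index mass (`15367·[m′ = n] ≤ 15367·4^{−(m′−n)}`). -/
theorem klIdxOverlap_le_klIdxMass (n m' : ℕ) : klIdxOverlap n m' ≤ klIdxMass n m' := by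
  unfold klIdxOverlap klIdxMass
  split_ifs with h
  · subst h; simp
  · positivity

/-- `(n+2)(4n+51) ≤ 105·2ⁿ`. -/
theorem klam_poly_le_pow (n : ℕ) : ((n : ℝ) + 2) * (4 * n + 51) ≤ 105 * 2 ^ n := by
  induction n with
  | zero => norm_num
  | succ k ih =>
      push_cast
      rw [pow_succ]
      nlinarith [ih, sq_nonneg (k : ℝ), (k.cast_nonneg : (0 : ℝ) ≤ k)]

/-- **The gain layer cake per unit `3mA` is below `2.1·2⁻ⁿ`** at `I = 2n` under the U-door row `mA·(4·15367) ≤ 1/3`: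
`3mA·(n+2)·((2·61524/π)·4^{−(m₁−n)}·Λₙ·(1 + 4n) + 4·klIdxMass n m₁/4ⁿ) ≤ (21/10)·2⁻ⁿ`. -/
theorem klam_gain_numeric_le {mA : ℝ} (hsm : mA * (4 * 15367) ≤ 1 / 3) (n m₁ : ℕ) :
    3 * mA * ((n + 2) * (2 * 61524 / Real.pi * ((4 : ℝ) ^ (m₁ - n))⁻¹ * klScale klE0 n * (1 + 2 * ((2 * n : ℕ) : ℝ)) +
      4 * klIdxMass n m₁ / 2 ^ (2 * n))) ≤ 21 / 10 * ((2 : ℝ) ^ n)⁻¹ := by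
  have hπ := Real.pi_gt_d2
  have hπ0 := Real.pi_pos
  have hx : (0 : ℝ) < 4 ^ n := by positivity
  have h2 : (0 : ℝ) < 2 ^ n := by positivity
  have hx2 : (2 : ℝ) ^ (2 * n) = 4 ^ n := by rw [pow_mul]; norm_num
  have hx2' : ((2 : ℝ) ^ n) * 2 ^ n = 4 ^ n := by rw [← hx2, two_mul, pow_add]
  have hcast : ((2 * n : ℕ) : ℝ) = 2 * n := by push_cast; ring
  have hΛ : klScale klE0 n = 1 / 32 * ((4 : ℝ) ^ n)⁻¹ := by unfold klScale klE0; ring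
  have hinv : ((4 : ℝ) ^ (m₁ - n))⁻¹ ≤ 1 := inv_le_one_of_one_le₀ (one_le_pow₀ (by norm_num))
  have hIM : klIdxMass n m₁ ≤ 15367 := klIdxMass_le n m₁
  have hIM0 : 0 ≤ klIdxMass n m₁ := klIdxMass_nonneg n m₁
  have h3m : 3 * mA ≤ 1 / 61468 := by linarith
  have hn0 : (0 : ℝ) ≤ n := n.cast_nonneg
  rw [hcast, hx2, hΛ]
  -- the two summands per unit `3mA`
  have hA : 3 * mA * (2 * 61524 / Real.pi * ((4 : ℝ) ^ (m₁ - n))⁻¹ * (1 / 32 * ((4 : ℝ) ^ n)⁻¹) * (1 + 2 * (2 * n))) ≤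
      (1 + 4 * n) / 50 * ((4 : ℝ) ^ n)⁻¹ := by
    have hx' : 0 < ((4 : ℝ) ^ n)⁻¹ := by positivity
    have h14 : (0 : ℝ) ≤ 1 + 4 * n := by positivity
    -- `3mA·(123048/π)/32 ≤ 1/50` from `3mA ≤ 1/61468` and `π > 3.14`
    have hkey : 3 * mA * (2 * 61524 / Real.pi * ((4 : ℝ) ^ (m₁ - n))⁻¹ * (1 / 32)) ≤ 1 / 50 := by
      have h1 : 2 * 61524 / Real.pi * ((4 : ℝ) ^ (m₁ - n))⁻¹ * (1 / 32) ≤ 2 * 61524 / Real.pi * (1 / 32) := by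
        have : 0 ≤ 2 * 61524 / Real.pi := by positivity
        nlinarith
      have h2' : 2 * 61524 / Real.pi * (1 / 32) ≤ 2 * 61524 / 3.14 * (1 / 32) := by
        have : 2 * 61524 / Real.pi ≤ 2 * 61524 / 3.14 := div_le_div_of_nonneg_left (by norm_num) (by norm_num) hπ.le
        linarith
      calc 3 * mA * (2 * 61524 / Real.pi * ((4 : ℝ) ^ (m₁ - n))⁻¹ * (1 / 32)) ≤ 1 / 61468 * (2 * 61524 / 3.14 * (1 / 32)) :=
            mul_le_mul h3m (h1.trans h2') (by positivity) (by norm_num)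
        _ ≤ 1 / 50 := by norm_num
    calc 3 * mA * (2 * 61524 / Real.pi * ((4 : ℝ) ^ (m₁ - n))⁻¹ * (1 / 32 * ((4 : ℝ) ^ n)⁻¹) * (1 + 2 * (2 * n)))
        = 3 * mA * (2 * 61524 / Real.pi * ((4 : ℝ) ^ (m₁ - n))⁻¹ * (1 / 32)) * ((1 + 4 * n) * ((4 : ℝ) ^ n)⁻¹) := by ring
      _ ≤ 1 / 50 * ((1 + 4 * n) * ((4 : ℝ) ^ n)⁻¹) := mul_le_mul_of_nonneg_right hkey (by positivity)
      _ = (1 + 4 * n) / 50 * ((4 : ℝ) ^ n)⁻¹ := by ring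
  have hB : 3 * mA * (4 * klIdxMass n m₁ / 4 ^ n) ≤ ((4 : ℝ) ^ n)⁻¹ := by
    rw [div_eq_mul_inv]
    have : 3 * mA * (4 * klIdxMass n m₁) ≤ 1 := by
      calc 3 * mA * (4 * klIdxMass n m₁) ≤ 1 / 61468 * (4 * 15367) := mul_le_mul h3m (by linarith) (by positivity) (by norm_num)
        _ = 1 := by norm_num
    calc 3 * mA * (4 * klIdxMass n m₁ * ((4 : ℝ) ^ n)⁻¹) = 3 * mA * (4 * klIdxMass n m₁) * ((4 : ℝ) ^ n)⁻¹ := by ring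
      _ ≤ 1 * ((4 : ℝ) ^ n)⁻¹ := mul_le_mul_of_nonneg_right this (by positivity)
      _ = ((4 : ℝ) ^ n)⁻¹ := one_mul _
  have hpoly := klam_poly_le_pow n
  have hn2 : (0 : ℝ) ≤ n + 2 := by positivity
  calc 3 * mA * ((n + 2) * (2 * 61524 / Real.pi * ((4 : ℝ) ^ (m₁ - n))⁻¹ * (1 / 32 * ((4 : ℝ) ^ n)⁻¹) * (1 + 2 * (2 * n)) + 4 * klIdxMass n m₁ / 4 ^ n))
      = (n + 2) * (3 * mA * (2 * 61524 / Real.pi * ((4 : ℝ) ^ (m₁ - n))⁻¹ * (1 / 32 * ((4 : ℝ) ^ n)⁻¹) * (1 + 2 * (2 * n))) +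
          3 * mA * (4 * klIdxMass n m₁ / 4 ^ n)) := by ring
    _ ≤ (n + 2) * ((1 + 4 * n) / 50 * ((4 : ℝ) ^ n)⁻¹ + ((4 : ℝ) ^ n)⁻¹) := mul_le_mul_of_nonneg_left (add_le_add hA hB) hn2
    _ = ((n + 2) * (4 * n + 51)) / 50 * ((4 : ℝ) ^ n)⁻¹ := by ring
    _ ≤ 105 * 2 ^ n / 50 * ((4 : ℝ) ^ n)⁻¹ := by gcongr
    _ = 21 / 10 * ((2 : ℝ) ^ n)⁻¹ := by
        rw [← hx2']
        field_simp
        ring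

end Numerics

/-! ## §2 The conversion row at `RB := θ·transferBarRelIdx`, `θ ≤ 1/5` -/

section Arith

/-- **Pure arithmetic of the conversion row.**  Slots `K2 = (KlamU)²`, `T = cubic + thermal`, weights `ms ≥ ov ≥ 0`, `c2 = 2⁻ⁿ ≥ c4 = 4⁻ⁿ`, `c2 ≥ 0`, `cL = 1/L ≥ 0`; the U-door row in
the form `(3/2)·mA·(4·ms) ≤ 1/2`, the gain numerics `3mA·Gn ≤ 2.1·c2`, `0 ≤ θ ≤ 1/5`; the bar's floor `ρr·(K2·(c2 + cL)·ms + T·ms) ≤ Tb(k,k′)`, the windowed convolution bound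
`conv ≤ ρr·(K2·((2Gn + (c2 + cL)·4ms)·ms + c4·ov·4ms) + T·ms·4ms)` and `S ≤ θ·(3mA/2)·conv` ⟹ `θ·Tb(k,k′) + S ≤ Tb(k,k′)`. -/
theorem klam_exportRow_arith {ρr K2 T ms ov c2 c4 cL mA Gn θ Tbk conv S : ℝ}
    (hρr : 0 ≤ ρr) (hK2 : 0 ≤ K2) (hT : 0 ≤ T) (hms : 0 ≤ ms) (hov : 0 ≤ ov) (hovms : ov ≤ ms) (hc2 : 0 ≤ c2) (hc42 : c4 ≤ c2)
    (hcL : 0 ≤ cL) (hmA : 0 ≤ mA) (hZ : 3 / 2 * mA * (4 * ms) ≤ 1 / 2) (hG : 3 * mA * Gn ≤ 21 / 10 * c2) (hθ0 : 0 ≤ θ) (hθ : θ ≤ 1 / 5)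
    (hfloor : ρr * (K2 * ((c2 + cL) * ms) + T * ms) ≤ Tbk)
    (hconv : conv ≤ ρr * (K2 * ((2 * Gn + (c2 + cL) * (4 * ms)) * ms + c4 * ov * (4 * ms)) + T * ms * (4 * ms)))
    (hS : S ≤ θ * (3 / 2 * mA) * conv) :
    θ * Tbk + S ≤ Tbk := by
  have hF0 : 0 ≤ ρr * (K2 * ((c2 + cL) * ms) + T * ms) := by positivity
  have hTbk : 0 ≤ Tbk := hF0.trans hfloor
  -- term by term, per unit `(3/2)·mA`
  have t1 : 3 / 2 * mA * (2 * Gn) ≤ 21 / 10 * (c2 + cL) := by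
    have : 3 / 2 * mA * (2 * Gn) = 3 * mA * Gn := by ring
    rw [this]; linarith
  have t2 : 3 / 2 * mA * ((c2 + cL) * (4 * ms)) ≤ 1 / 2 * (c2 + cL) := by
    have : 3 / 2 * mA * ((c2 + cL) * (4 * ms)) = (c2 + cL) * (3 / 2 * mA * (4 * ms)) := by ring
    rw [this]
    have hc : 0 ≤ c2 + cL := by positivity
    nlinarith
  have t3 : 3 / 2 * mA * (c4 * ov * (4 * ms)) ≤ 1 / 2 * ((c2 + cL) * ms) := by
    have : 3 / 2 * mA * (c4 * ov * (4 * ms)) = c4 * ov * (3 / 2 * mA * (4 * ms)) := by ring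
    rw [this]
    calc c4 * ov * (3 / 2 * mA * (4 * ms)) ≤ c2 * ms * (1 / 2) := mul_le_mul (mul_le_mul hc42 hovms hov hc2) hZ (by positivity) (by positivity)
      _ ≤ (c2 + cL) * ms * (1 / 2) := by gcongr; linarith
      _ = 1 / 2 * ((c2 + cL) * ms) := by ring
  have t4 : 3 / 2 * mA * (T * ms * (4 * ms)) ≤ 1 / 2 * (T * ms) := by
    have : 3 / 2 * mA * (T * ms * (4 * ms)) = T * ms * (3 / 2 * mA * (4 * ms)) := by ring
    rw [this]
    have : 0 ≤ T * ms := by positivity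
    nlinarith
  have hkey : 3 / 2 * mA * (ρr * (K2 * ((2 * Gn + (c2 + cL) * (4 * ms)) * ms + c4 * ov * (4 * ms)) + T * ms * (4 * ms))) ≤
      31 / 10 * (ρr * (K2 * ((c2 + cL) * ms) + T * ms)) := by
    have hsplit : 3 / 2 * mA * (ρr * (K2 * ((2 * Gn + (c2 + cL) * (4 * ms)) * ms + c4 * ov * (4 * ms)) + T * ms * (4 * ms))) =
        ρr * (K2 * ((3 / 2 * mA * (2 * Gn) + 3 / 2 * mA * ((c2 + cL) * (4 * ms))) * ms + 3 / 2 * mA * (c4 * ov * (4 * ms))) +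
          3 / 2 * mA * (T * ms * (4 * ms))) := by ring
    rw [hsplit]
    have e1 : (3 / 2 * mA * (2 * Gn) + 3 / 2 * mA * ((c2 + cL) * (4 * ms))) * ms ≤ (21 / 10 * (c2 + cL) + 1 / 2 * (c2 + cL)) * ms :=
      mul_le_mul_of_nonneg_right (add_le_add t1 t2) hms
    have e2 : K2 * ((3 / 2 * mA * (2 * Gn) + 3 / 2 * mA * ((c2 + cL) * (4 * ms))) * ms + 3 / 2 * mA * (c4 * ov * (4 * ms))) ≤
        K2 * ((21 / 10 * (c2 + cL) + 1 / 2 * (c2 + cL)) * ms + 1 / 2 * ((c2 + cL) * ms)) := mul_le_mul_of_nonneg_left (add_le_add e1 t3) hK2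
    have e3 : K2 * ((3 / 2 * mA * (2 * Gn) + 3 / 2 * mA * ((c2 + cL) * (4 * ms))) * ms + 3 / 2 * mA * (c4 * ov * (4 * ms))) +
        3 / 2 * mA * (T * ms * (4 * ms)) ≤ 31 / 10 * (K2 * ((c2 + cL) * ms) + T * ms) := by
      have hKc : 0 ≤ K2 * ((c2 + cL) * ms) := by positivity
      have hTm : 0 ≤ T * ms := by positivity
      nlinarith [e2, t4]
    exact mul_le_mul_of_nonneg_left e3 hρr |>.trans_eq (by ring)
  -- assemble
  have hθm : 0 ≤ θ * (3 / 2 * mA) := by positivity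
  have h1 : S ≤ θ * (31 / 10 * Tbk) := by
    calc S ≤ θ * (3 / 2 * mA) * conv := hS
      _ ≤ θ * (3 / 2 * mA) * (ρr * (K2 * ((2 * Gn + (c2 + cL) * (4 * ms)) * ms + c4 * ov * (4 * ms)) + T * ms * (4 * ms))) :=
          mul_le_mul_of_nonneg_left hconv hθm
      _ = θ * (3 / 2 * mA * (ρr * (K2 * ((2 * Gn + (c2 + cL) * (4 * ms)) * ms + c4 * ov * (4 * ms)) + T * ms * (4 * ms)))) := by ring
      _ ≤ θ * (31 / 10 * (ρr * (K2 * ((c2 + cL) * ms) + T * ms))) := mul_le_mul_of_nonneg_left hkey hθ0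
      _ ≤ θ * (31 / 10 * Tbk) := by gcongr
  nlinarith [h1, hTbk, hθ0, hθ]

end Arith

section Row

variable {L M : ℕ} [NeZero L] (β μ : ℝ) (K : TrigPolyC4v) {R : RenConsts} {U : ℝ} {N : ℕ}

/-- **`klam_exportRow_le`** — the Ẽ-organisation's conversion row CLOSES at one fifth of the public bar: admissible frame `K`, `klBetaMin ≤ β ≤ L`, `π/L ≤ Λₙ`, `n ≤ j′ ≤ j`,
`0 ≤ mA`, `mA·(4·15367) ≤ 1/3`, `0 ≤ θ ≤ 1/5`, `0 ≤ r`, `0 ≤ P.Klam`, `0 ≤ G.CF` ⇒ for every `k, k′` and every finite window `B`: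
`θ·Tb(k,k′) + Σ_c 𝟙[k ∈ B ∧ c ∈ B]·θ·Tb(k,c)·‖−(tₙ^K[s_{n,j}](Qm′,c) − tₙ^K[s_{n,j′}](Qm′,c))‖·(3mA/2) ≤ Tb(k,k′)`, `Tb := transferBarRelIdx L G P r β U n j′ Qm`. -/
theorem klam_exportRow_le (hKf : FrameOK R U N μ K) (hβ : klBetaMin ≤ β) (hβL : β ≤ L) {G : GeoConsts} (hCF : 0 ≤ G.CF) {P : SplitConsts} (hKl : 0 ≤ P.Klam)
    {r : ℝ} (hr : 0 ≤ r) {n j j' : ℕ} (hnj : n ≤ j') (hjj : j' ≤ j) (hη₀ : Real.pi / (L : ℝ) ≤ klScale klE0 n) {mA : ℝ} (hm : 0 ≤ mA)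
    (hsm : mA * (4 * 15367) ≤ 1 / 3) {θ : ℝ} (hθ0 : 0 ≤ θ) (hθ : θ ≤ 1 / 5) (B : Finset (TorusSite 2 L)) (Qm Qm' k k' : TorusSite 2 L) :
    θ * transferBarRelIdx L G P r β U n j' Qm k k' +
        ∑ c, (if k ∈ B ∧ c ∈ B then θ * transferBarRelIdx L G P r β U n j' Qm k c else 0) *
          ‖(-(((klTransferWeight L M β μ K n (softSymbolCompl L M β μ K n j) Qm' c - klTransferWeight L M β μ K n (softSymbolCompl L M β μ K n j') Qm' c : ℝ)) : ℂ))‖ *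
          (3 / 2 * mA) ≤ transferBarRelIdx L G P r β U n j' Qm k k' := by
  have hTb0 : ∀ c, 0 ≤ transferBarRelIdx L G P r β U n j' Qm k c := fun c => transferBarRelIdx_nonneg hCF hKl hr β U n j' Qm k c
  -- drop the indicator, convert the norms
  have hS : ∑ c, (if k ∈ B ∧ c ∈ B then θ * transferBarRelIdx L G P r β U n j' Qm k c else 0) *
      ‖(-(((klTransferWeight L M β μ K n (softSymbolCompl L M β μ K n j) Qm' c - klTransferWeight L M β μ K n (softSymbolCompl L M β μ K n j') Qm' c : ℝ)) : ℂ))‖ *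
        (3 / 2 * mA) ≤ θ * (3 / 2 * mA) * ∑ c, transferBarRelIdx L G P r β U n j' Qm k c *
          |klTransferWeight L M β μ K n (softSymbolCompl L M β μ K n j) Qm' c - klTransferWeight L M β μ K n (softSymbolCompl L M β μ K n j') Qm' c| := by
    rw [Finset.mul_sum]
    refine Finset.sum_le_sum fun c _ => ?_
    rw [norm_neg, Complex.norm_real, Real.norm_eq_abs]
    have hle : (if k ∈ B ∧ c ∈ B then θ * transferBarRelIdx L G P r β U n j' Qm k c else 0) ≤ θ * transferBarRelIdx L G P r β U n j' Qm k c := by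
      split_ifs
      · exact le_rfl
      · exact mul_nonneg hθ0 (hTb0 c)
    have h0 : 0 ≤ (if k ∈ B ∧ c ∈ B then θ * transferBarRelIdx L G P r β U n j' Qm k c else 0) := by
      split_ifs
      · exact mul_nonneg hθ0 (hTb0 c)
      · exact le_rfl
    have ha : 0 ≤ |klTransferWeight L M β μ K n (softSymbolCompl L M β μ K n j) Qm' c - klTransferWeight L M β μ K n (softSymbolCompl L M β μ K n j') Qm' c| :=
      abs_nonneg _
    calc (if k ∈ B ∧ c ∈ B then θ * transferBarRelIdx L G P r β U n j' Qm k c else 0) *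
          |klTransferWeight L M β μ K n (softSymbolCompl L M β μ K n j) Qm' c - klTransferWeight L M β μ K n (softSymbolCompl L M β μ K n j') Qm' c| * (3 / 2 * mA)
        ≤ θ * transferBarRelIdx L G P r β U n j' Qm k c *
          |klTransferWeight L M β μ K n (softSymbolCompl L M β μ K n j) Qm' c - klTransferWeight L M β μ K n (softSymbolCompl L M β μ K n j') Qm' c| * (3 / 2 * mA) := by
          gcongr
      _ = θ * (3 / 2 * mA) * (transferBarRelIdx L G P r β U n j' Qm k c *
          |klTransferWeight L M β μ K n (softSymbolCompl L M β μ K n j) Qm' c - klTransferWeight L M β μ K n (softSymbolCompl L M β μ K n j') Qm' c|) := by ring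
  -- the windowed convolution bound at `I = 2n` and the gain numerics
  have hconv := klam_transferBarRelIdx_conv_transferWeight_le (M := M) β μ K hKf hβ hβL hCF hKl hr n j' (2 * n) hnj hjj hη₀ Qm Qm' k
  have hG := klam_gain_numeric_le hsm n j'
  -- the floor of the bar at `(k, k′)`
  have hfloor : klIdxPrefactor r n * ((P.Klam * U) ^ 2 * (((((2 : ℝ) ^ n)⁻¹ + ((L : ℝ))⁻¹)) * klIdxMass n j') +
      ((P.Klam * |U|) ^ 3 * ((2 : ℝ) ^ n)⁻¹ + thermalBar G P U β n) * klIdxMass n j') ≤ transferBarRelIdx L G P r β U n j' Qm k k' := by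
    rw [transferBarRelIdx_eq, transferBarRelAtWF_eq]
    have hg₁ : 0 ≤ klRelGain n (klTorusNorm L (k - k')) := klRelGain_nonneg n (torusSupNorm_nonneg _)
    have hg₂ : 0 ≤ klRelGain n (klTorusNorm L (k + k' - Qm)) := klRelGain_nonneg n (torusSupNorm_nonneg _)
    have hK2 : 0 ≤ (P.Klam * U) ^ 2 := by positivity
    have hms : 0 ≤ klIdxMass n j' := klIdxMass_nonneg n j'
    have hov : 0 ≤ ((4 : ℝ) ^ n)⁻¹ * klIdxOverlap n j' := mul_nonneg (by positivity) (klIdxOverlap_nonneg n j')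
    have h1 : (((2 : ℝ) ^ n)⁻¹ + ((L : ℝ))⁻¹) * klIdxMass n j' ≤
        (klRelGain n (klTorusNorm L (k - k')) + klRelGain n (klTorusNorm L (k + k' - Qm)) + ((2 : ℝ) ^ n)⁻¹ + ((L : ℝ))⁻¹) * klIdxMass n j' +
          ((4 : ℝ) ^ n)⁻¹ * klIdxOverlap n j' := by nlinarith
    have h2 := mul_le_mul_of_nonneg_left h1 hK2
    exact mul_le_mul_of_nonneg_left (by linarith) (klIdxPrefactor_nonneg hr n)
  have hZ : 3 / 2 * mA * (4 * klIdxMass n j') ≤ 1 / 2 := by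
    have := klIdxMass_le n j'
    have := klIdxMass_nonneg n j'
    nlinarith
  have h2pos : 0 < ((2 : ℝ) ^ n)⁻¹ := by positivity
  have h42 : ((4 : ℝ) ^ n)⁻¹ ≤ ((2 : ℝ) ^ n)⁻¹ :=
    inv_anti₀ (by positivity) (pow_le_pow_left₀ (by norm_num : (0 : ℝ) ≤ 2) (by norm_num : (2 : ℝ) ≤ 4) n)
  have hT : 0 ≤ (P.Klam * |U|) ^ 3 * ((2 : ℝ) ^ n)⁻¹ + thermalBar G P U β n := by
    have := thermalBar_nonneg' hCF P U β n; positivity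
  exact klam_exportRow_arith (klIdxPrefactor_nonneg hr n) (by positivity) hT (klIdxMass_nonneg n j') (klIdxOverlap_nonneg n j')
    (klIdxOverlap_le_klIdxMass n j') h2pos.le h42 (by positivity) hm hZ hG hθ0 hθ hfloor hconv hS

end Row

/-! ## §3 EXPORT of the private family at one fifth of the public bar -/

section Export

variable (L M : ℕ) [NeZero L] [NeZero M]

/-- **`pairTransferRelFamilyK5_of_relResIdx_fifth`** — the Ẽ-organisation's EXPORT with the conversion row DISCHARGED: the private relative-residue family of the
cutoff-built pairs at scale `n` with bars `θ·transferBarRelIdx L G P r β U n j′ Qm` (`0 ≤ θ ≤ 1/5`) on the bare ball, the a priori size `|A°ₙ[s_{n,j′}]| ≤ mA`, the U-door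
row `mA·(4·15367) ≤ 1/3`, the frame binders (`FrameOK` of `Kₙ`, `klBetaMin ≤ β ≤ L`, `π/L ≤ Λₙ`) and `0 ≤ r`, `0 ≤ P.Klam`, `0 ≤ G.CF` ⟹ `PairTransferRelFamilyK5 L M G P r β U μ n`. -/
theorem pairTransferRelFamilyK5_of_relResIdx_fifth {R : RenConsts} {N : ℕ} {G : GeoConsts} (hCF : 0 ≤ G.CF) {P : SplitConsts} (hKl : 0 ≤ P.Klam)
    {r β U μ : ℝ} (hr : 0 ≤ r) {n : ℕ} (hKf : FrameOK R U N μ (klFlowFrameU L M β U μ n)) (hβ : klBetaMin ≤ β) (hβL : β ≤ L)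
    (hη₀ : Real.pi / (L : ℝ) ≤ klScale klE0 n) {mA : ℝ} (hm : 0 ≤ mA) (hsm : mA * (4 * 15367) ≤ 1 / 3) {θ : ℝ} (hθ0 : 0 ≤ θ) (hθ : θ ≤ 1 / 5)
    (hhist : ∀ j j' : ℕ, n ≤ j' → j' ≤ j → j ≤ nScales β + 1 → ∀ Qm : TorusSite 2 L, IsPairClassAt L Qm n →
      ∀ k ∈ klBall L μ 0, ∀ k' ∈ klBall L μ 0,
      ‖(klMemberArrayF L M β U μ n (softSymbolCompl L M β μ (klFlowFrameU L M β U μ n) n j) Qm + klMemberArrayF L M β U μ n (softSymbolCompl L M β μ (klFlowFrameU L M β U μ n) n j) Qm *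
          diagonal (fun c => -(((klTransferWeight L M β μ (klFlowFrameU L M β U μ n) n (softSymbolCompl L M β μ (klFlowFrameU L M β U μ n) n j) Qm c -
            klTransferWeight L M β μ (klFlowFrameU L M β U μ n) n (softSymbolCompl L M β μ (klFlowFrameU L M β U μ n) n j') Qm c : ℝ)) : ℂ)) * klMemberArrayF L M β U μ n (softSymbolCompl L M β μ (klFlowFrameU L M β U μ n) n j') Qm -
          klMemberArrayF L M β U μ n (softSymbolCompl L M β μ (klFlowFrameU L M β U μ n) n j') Qm) k k'‖ ≤ θ * transferBarRelIdx L G P r β U n j' Qm k k')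
    (hA : ∀ j' : ℕ, n ≤ j' → j' ≤ nScales β + 1 → ∀ Qm : TorusSite 2 L, IsPairClassAt L Qm n →
      ∀ x y, ‖klMemberArrayF L M β U μ n (softSymbolCompl L M β μ (klFlowFrameU L M β U μ n) n j') Qm x y‖ ≤ mA) :
    PairTransferRelFamilyK5 L M G P r β U μ n := by
  refine pairTransferRelFamilyK5_of_relResIdx L M hm (RB := fun _ _ j' Qm k k' => θ * transferBarRelIdx L G P r β U n j' Qm k k') hhist ?_
  intro j j' h1 h2 h3 Qm hQm
  refine ⟨hA j' h1 (h2.trans h3) Qm hQm, ?_, fun k _ k' _ => ?_⟩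
  · -- `mA·Σ_c |tₙ[s_j](c) − tₙ[s_j′](c)| ≤ 1/3` from the U-door row
    have h := mul_sum_abs_klTransferWeight_compl_sub_le_third (M := M) β μ (klFlowFrameU L M β U μ n) hKf hβ hβL h1 h2 Qm hm hsm
    refine le_of_eq_of_le ?_ h
    congr 1
    refine Finset.sum_congr rfl fun c _ => ?_
    rw [norm_neg, Complex.norm_real, Real.norm_eq_abs]
  · exact klam_exportRow_le β μ (klFlowFrameU L M β U μ n) hKf hβ hβL hCF hKl hr h1 h2 hη₀ hm hsm hθ0 hθ (klBall L μ 0) Qm Qm k k'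

end Export

end Summit.HubbardSuperconductivity.HubbardSuperconductivity.Theorems.KLRegimeSplit

end
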